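import Mathlib.FieldTheory.AbsoluteGaloisGroup
import Mathlib.FieldTheory.KrullTopology
import Mathlib.RingTheory.Algebraic.Cardinality
import Mathlib.LinearAlgebra.FiniteDimensional.Defs
import HarnessLib

/-!
# The absolute Galois group of a countable field is second countable ([IUTchI] Rmk 2.5.3 (ii) (E1))

Mochizuki, *Inter-universal Teichmüller theory I*, §2, Remark 2.5.3 (ii) (E1), kurims manuscript
(May 2020) p. 53: "all topological subquotients of absolute Galois groups of fields of countable
cardinality are Galois-countable" [(T1) p. 52: "its topology admits a countable basis"].  This
Mathlib-only file PROVES the core statement (abc-iut cell, layer L5, abc-iut-L5-t6; the typed claim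
`Rmk253.CountableFieldGaloisSecondCountable` lives in `CoveringsErrata.lean`, whose `_holds` companion
imports this file):

* `secondCountableTopology_algEquiv` — for an integral (e.g. algebraic) extension `L/K` with `L`
  countable, the automorphism group `L ≃ₐ[K] L` with the Krull topology is second countable: the sets
  `{σ | ∀ (x, y) ∈ t, σ x = y}`, `t` a finite subset of `L × L`, are open (translates of the open
  stabilizers `stabilizer_isOpen_of_isIntegral`) and form a basis (a Krull neighbourhood `σ · Gal(L/E)`,
  `E/K` finite, contains the basic set recording the values of `σ` on a `K`-basis of `E`); there are
  countably many of them.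
* `countable_algebraicClosure` — an algebraic closure of a countable field is countable
  (Mathlib `Algebra.IsAlgebraic.cardinalMk_le_max`).
* `secondCountableTopology_absoluteGaloisGroup` — hence `Field.absoluteGaloisGroup K` is second
  countable for `K` countable.

No side is taken on [IUTchIII] Cor. 3.12; this is elementary field theory.
-/

open Topology TopologicalSpace

namespace Literature.IUT.HodgeTheaters

namespace Rmk253

universe u v

/-- An algebraic (integral) extension field `L` of `K` that is countable has second countable
automorphism group `L ≃ₐ[K] L` (Krull topology): the sets of automorphisms with prescribed values on
a finite subset of `L` form a countable basis.  The mechanism of [IUTchI] Rmk. 2.5.3 (ii) (E1).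
[cite: Mochizuki2012, IUTchI Rmk 2.5.3 (ii) (E1) p.53] -/
theorem secondCountableTopology_algEquiv (K : Type u) (L : Type v) [Field K] [Field L] [Algebra K L]
    [Algebra.IsIntegral K L] [Countable L] : SecondCountableTopology (L ≃ₐ[K] L) := by
  classical
  -- the basic sets: automorphisms with prescribed values on a finite set
  let B : Finset (L × L) → Set (L ≃ₐ[K] L) := fun t => {σ | ∀ q ∈ t, σ q.1 = q.2}
  -- each `{σ | σ x = y}` is open
  have hpt : ∀ x y : L, IsOpen {σ : L ≃ₐ[K] L | σ x = y} := by
    intro x y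
    by_cases h : ∃ σ₀ : L ≃ₐ[K] L, σ₀ x = y
    · obtain ⟨σ₀, hσ₀⟩ := h
      have hset : {σ : L ≃ₐ[K] L | σ x = y} =
          (fun σ => σ₀⁻¹ * σ) ⁻¹' (MulAction.stabilizer (L ≃ₐ[K] L) x : Set (L ≃ₐ[K] L)) := by
        ext σ
        simp only [Set.mem_setOf_eq, Set.mem_preimage, SetLike.mem_coe,
          MulAction.mem_stabilizer_iff, AlgEquiv.smul_def, AlgEquiv.mul_apply, AlgEquiv.aut_inv]
        constructor
        · intro hσ
          rw [hσ, ← hσ₀, AlgEquiv.symm_apply_apply]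
        · intro hσ
          have := congrArg σ₀ hσ
          rwa [AlgEquiv.apply_symm_apply, hσ₀] at this
      rw [hset]
      exact (stabilizer_isOpen_of_isIntegral x).preimage (continuous_const_mul σ₀⁻¹)
    · have hset : {σ : L ≃ₐ[K] L | σ x = y} = ∅ :=
        Set.eq_empty_iff_forall_notMem.mpr fun σ hσ => h ⟨σ, hσ⟩
      rw [hset]
      exact isOpen_empty
  have hBopen : ∀ t, IsOpen (B t) := by
    intro t
    have : B t = ⋂ q ∈ t, {σ : L ≃ₐ[K] L | σ q.1 = q.2} := by
      ext σ
      simp only [B, Set.mem_setOf_eq, Set.mem_iInter]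
    rw [this]
    exact isOpen_biInter_finset fun q _ => hpt q.1 q.2
  -- they form a basis
  have hBasis : IsTopologicalBasis (Set.range B) := by
    apply isTopologicalBasis_of_isOpen_of_nhds
    · rintro _ ⟨t, rfl⟩
      exact hBopen t
    · intro σ U hσU hU
      have h1 : (fun τ => σ * τ) ⁻¹' U ∈ 𝓝 (1 : L ≃ₐ[K] L) :=
        (hU.preimage (continuous_const_mul σ)).mem_nhds (by simpa using hσU)
      obtain ⟨E, hEfd, hE⟩ := (krullTopology_mem_nhds_one_iff K L _).mp h1
      haveI := hEfd
      let b := Module.finBasis K E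
      let t : Finset (L × L) := Finset.univ.image fun i => ((b i : L), σ (b i))
      refine ⟨B t, ⟨t, rfl⟩, ?_, ?_⟩
      · intro q hq
        obtain ⟨i, -, rfl⟩ := Finset.mem_image.mp hq
        rfl
      · intro τ hτ
        have hb : ∀ i, τ (b i : L) = σ (b i) := fun i =>
          hτ ((b i : L), σ (b i)) (Finset.mem_image.mpr ⟨i, Finset.mem_univ _, rfl⟩)
        -- `σ⁻¹ * τ` fixes `E` pointwise
        have hfix : σ⁻¹ * τ ∈ E.fixingSubgroup := by
          rw [IntermediateField.mem_fixingSubgroup_iff]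
          intro x hx
          have hx' : (x : L) = E.val (∑ i, b.repr ⟨x, hx⟩ i • b i) := by
            rw [b.sum_repr]; rfl
          rw [hx', map_sum, map_sum]
          refine Finset.sum_congr rfl fun i _ => ?_
          rw [map_smul, map_smul, AlgEquiv.mul_apply, AlgEquiv.aut_inv, IntermediateField.val_mk,
            hb i, AlgEquiv.symm_apply_apply]
        have hmem : σ⁻¹ * τ ∈ (fun τ => σ * τ) ⁻¹' U := hE hfix
        simpa using hmem
  exact ⟨⟨Set.range B, Set.countable_range B, hBasis.eq_generateFrom⟩⟩

/-- An algebraic closure of a countable field is countable (the cardinality of an algebraic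
extension is at most `max #K ℵ₀`). [cite: Mochizuki2012, IUTchI Rmk 2.5.3 (ii) (E1) p.53] -/
theorem countable_algebraicClosure (K : Type u) [Field K] [Countable K] :
    Countable (AlgebraicClosure K) := by
  rw [← Cardinal.mk_le_aleph0_iff]
  calc Cardinal.mk (AlgebraicClosure K) ≤ max (Cardinal.mk K) Cardinal.aleph0 :=
        Algebra.IsAlgebraic.cardinalMk_le_max K (AlgebraicClosure K)
    _ ≤ Cardinal.aleph0 := max_le Cardinal.mk_le_aleph0 le_rfl

/-- **[IUTchI] Remark 2.5.3 (ii) (E1)**, p. 53, core case, PROVED: the absolute Galois group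
(Mathlib `Field.absoluteGaloisGroup`, Krull topology) of a countable field is second countable
("Galois-countable"). [cite: Mochizuki2012, IUTchI Rmk 2.5.3 (ii) (E1) p.53] -/
theorem secondCountableTopology_absoluteGaloisGroup (K : Type u) [Field K] [Countable K] :
    SecondCountableTopology (Field.absoluteGaloisGroup K) := by
  haveI := countable_algebraicClosure K
  exact secondCountableTopology_algEquiv K (AlgebraicClosure K)

end Rmk253

end Literature.IUT.HodgeTheaters
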